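/-
Copyright: lit-balaban Phase-2 proof seat p08 (gen 10).  Statement-level skeleton of a published paper; no proof claims beyond what
the kernel checks below.
-/
import Literature.MathematicalPhysics.QuantumFieldTheory.BalabanImbrieJaffe1984to88.BIJ88W1Prime543CurlBoundTorus
import Literature.MathematicalPhysics.QuantumFieldTheory.BalabanImbrieJaffe1984to88.BIJ88W1Ineq547Torus

/-!
# `BalabanImbrieJaffe1984to88.BIJ88W1PrimeCurlIneq547RSchedTorus` — T. Bałaban, J. Imbrie, A. Jaffe, *Effective action and cluster
properties of the abelian Higgs model*, Commun. Math. Phys. **114** (1988) 257–315 [BalabanImbrieJaffe1988], §5.4 p. 282 [PDF 26]: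
**THE p. 282 BOUNDS FOR `∂w′₁`, `∂*w′₁` WITH THE PRINTED RADII `ρ_j = r(e_j)` ((2.2)–(2.3)) ON ALL TORI OF THE SERIES, FOR `e_k` SMALL** —
r16's typed `Ineq547` inhabited for the curl member `∂w′₁` (p08's `dw1P`) and the divergence member `∂*w′₁` (p08's `sw1P`) of the tail kernel
`w′₁ = (𝒟_k − 𝒟_{k,loc})∂*Q^{e*}_k∂□` at the radius schedule OF THE PAPER `rSched L ε e r d` (`ρ_j = r(e_j) = |log e_j⁻¹|^r`,
`e_j = (L^jε)^{(4−d)/2}e`), with ONE rate `c > 0` and for all `e_k` in a punctured right neighbourhood of `0` — the threshold `ρ_k ≥ ρ₁` and the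
scale gap `ρ_j ≥ ρ_k + (k−j)θ₀` of p08's `ineq547_dw1P_allTori` / `ineq547_sw1P_allTori` (file `BIJ88W1Prime543CurlBoundTorus`) being supplied,
exactly as in p02's `ineq547_w1P_allTori_rSched` for the entry member, by p08 g4's `rLen_scale_gap` and p02's `schedule_eventually`.
The ∂-side twin of p02 g12's `BIJ88W1Ineq547Torus` §3; last file of the p08 ∂-programme for r16's flip condition of row C2.Eq5.4.7
(`BIJ88W1PrimeCurlLeftFactorTorus` → `BIJ88W1Prime543CurlDivTorus` → `BIJ88W1Prime543CurlBoundTorus` → this file).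

statement-level skeleton of published theorems with citation tags; proofs where landed; nothing here is a claim about the Yang–Mills mass gap

PDF held: `paper:balaban1988-cmp114-bij-abelian-higgs-effective-action` (journal page = PDF page + 256).  Pages re-read this session from the
materialised text layer: p. 282 [PDF 26] tl.4–12 (the `w′₁` display and *"and similarly for w′₁, ∂*w′₁"*), p. 260 [PDF 4] (2.2)–(2.3).

CITATION HEADER (lean-in-tree rule).  Part of the lit-balaban TYPED SKELETON (HOME `run/shared/lean/pub/lit-balaban/`), Phase-2 proof seat
p08 (gen 10), unit `lit-balaban-p08`; free-target protocol G.5-34(d) (split with p02 g12 agreed 2026-08-22T02:47Z: p02 = `w′₁`/`w₁`,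
p08 = `∂w′₁`/`∂*w′₁`).  WHAT IS REPRODUCED = SKELETON row **C2.Eq5.4.7** (owner r16, referee ref-5), the p. 282 clause *"and similarly for
[∂]w′₁, ∂*w′₁"* at the printed radii, kind «model instance for the kernels of record».  Decls used BY NAME (nothing restated): p08's
`ineq547_dw1P_allTori`, `ineq547_sw1P_allTori`; p02 g12's `BIJ88W1Ineq547Torus.schedule_eventually`; p08 g4's
`BIJ88Ineq547W1Prime.rLen_scale_gap`; r18's `rSched`, `eK`, `rLen`; r16's typed `Ineq547`.

THE PRINTED TEXT (p. 282 [PDF 26], verbatim from the text layer): *"≦ e^{−cr(e_k)}e^{−c dist(p,b′)}, and similarly for w′₁, ∂*w′₁."*;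
p. 260 (2.2) *"e_k = (L^kε)^{(4−d)/2}e"*, (2.3) *"r(e_k) = |log e_k⁻¹|^r, r > 1"*.  (The first *"w′₁"* of the clause is read `∂w′₁` — the
display it follows bounds `w′₁` itself; reading of record of row C2.Eq5.4.7, r16.)

WHAT IS PROVED (0 `sorry`, standard axioms; theorems only — proof lane):
* **`ineq547_dw1P_allTori_rSched`** (`2 ≤ d < 4`, `L` odd `> 1`, `r > 1`): `∃ c > 0, ∀ᶠ e_k ∈ 𝓝[>] 0, ∀` torus (`P.d = d`, `P.L = L`)
  `∀ k ≤ m + K ∀ ε, e > 0` realizing `e_k` `∀ |χ| ≤ 1`: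
  `Ineq547 (TPlaq P 0) (PBond P k) (dw1P … (rSched L ε e r d) k χ) (dist_k(p₋, b′₋)) c (rSched L ε e r d k)`.
* **`ineq547_sw1P_allTori_rSched`**: the same for `sw1P` on `TSite P 0` with `dist_k(x, b′₋)`.
HONEST SCOPE.  (i) The `e_k`-smallness is an `∀ᶠ … in 𝓝[>] 0` statement (threshold not computed); `d < 4` and `r > 1` as printed (for `d = 4`
the printed `e_k` does not decrease in `k` and there is no scale gap).  (ii) Everything else as in `BIJ88W1Prime543CurlBoundTorus`: `U = 1`,
real abelian fields, torus of the series, standing range `k ≤ m + K`, unit-lattice distance `dist_k` in units of `T₁^{(k)}`; constants explicit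
upstream, not optimal.  (iii) No `def`, no new named fact; NOT summit progress.  Unit `lit-balaban-p08` (literature-prover-lit-balaban-p08-g10-0),
2026-08-22.
-/

open scoped Topology
open Filter

namespace Literature.MathematicalPhysics.QuantumFieldTheory.BalabanImbrieJaffe1984to88.BIJ88W1PrimeCurlIneq547RSchedTorus

open Balaban1983to89 hiding Site Plaq
open Balaban1983to89.LatticeFieldCalculus
open BIJ88Sect2Statements (eK rLen)
open BIJ88Sect5StatementsPart2 (Ineq547)
open BIJ85Prop521Torus BIJ85Prop522Torus BIJ85Sigma422Eta
open BIJ85Sect7Statements BIJ85Ineq722Torus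
open BIJ88CurlyDkLocTorus (rSched)
open BIJ88W1Prime543CurlDivTorus (dw1P sw1P)
open BIJ88W1Prime543CurlBoundTorus (ineq547_dw1P_allTori ineq547_sw1P_allTori)
open BIJ88W1Ineq547Torus (schedule_eventually)
open BIJ88Ineq547W1Prime (rLen_scale_gap)

-- inside this namespace the bare `Site`/`Plaq` are the `ℤ^d` carriers of the QFT root; the torus ones are renamed:
open Balaban1983to89 renaming Site → TSite, Plaq → TPlaq

noncomputable section

/-- the printed schedule meets a threshold/gap pair `(ρ₁, θ₀)` once `e_k` is small: `ρ₁ ≤ r(e_k)` and `r(e_k) + (k−j)θ₀ ≤ r(e_j)` for `j < k`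
(p02's `schedule_eventually` + p08 g4's `rLen_scale_gap`). [cite: BalabanImbrieJaffe1988, (2.3) p.260] -/
theorem rSched_threshold_gap {d : ℕ} (hd4 : d < 4) {L : ℕ} (hL1 : (1 : ℝ) < (L : ℝ)) {r : ℝ} (hr : 1 < r) (ρ₁ θ₀ : ℝ) :
    ∀ᶠ ek in 𝓝[>] (0 : ℝ), ∀ (k : ℕ) (ε e : ℝ), 0 < ε → 0 < e → eK (L : ℝ) ε e d k = ek →
      ρ₁ ≤ rSched (L : ℝ) ε e r d k ∧ ∀ j < k, rSched (L : ℝ) ε e r d k + ((k - j : ℕ) : ℝ) * θ₀ ≤ rSched (L : ℝ) ε e r d j := by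
  filter_upwards [schedule_eventually hd4 hL1 hr ρ₁ θ₀] with ek hek
  obtain ⟨hρ, hθ, hek0, hek1⟩ := hek
  intro k ε e hε he hekk
  refine ⟨?_, ?_⟩
  · show ρ₁ ≤ rLen r (eK (L : ℝ) ε e d k)
    rwa [hekk]
  · intro j hj
    show rLen r (eK (L : ℝ) ε e d k) + ((k - j : ℕ) : ℝ) * θ₀ ≤ rLen r (eK (L : ℝ) ε e d j)
    have hgap := rLen_scale_gap hL1.le hε he hr.le (show d ≤ 4 by omega) (k := k) (by rw [hekk]; exact hek1) (by rw [hekk]; exact hek0)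
      (k - j) j (by omega)
    rw [hekk] at hgap ⊢
    have hm : 0 ≤ ((k - j : ℕ) : ℝ) := Nat.cast_nonneg _
    nlinarith [mul_le_mul_of_nonneg_left hθ hm]

/-- **(5.4.7)-SHAPE FOR `∂w′₁` WITH THE PRINTED RADII, ALL TORI, `e_k` SMALL** (`2 ≤ d < 4`, `L` odd `> 1`, `r > 1`): with the radius schedule of
the paper `ρ_j = r(e_j)` (r18's `rSched`, (2.2)–(2.3)), there is ONE `c > 0` such that for all sufficiently small `e_k > 0` (a punctured right
neighbourhood of `0`, uniform in the torus, in `k ≤ m + K`, in `ε, e > 0` realizing `e_k`, and in `|χ| ≤ 1`),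
`|(∂w′₁)(p, b′)| ≤ e^{−c·r(e_k)}e^{−c·dist_k(p₋,b′₋)}` — the threshold and the scale gap of `ineq547_dw1P_allTori` being supplied by
`rSched_threshold_gap`. [cite: BalabanImbrieJaffe1988, (5.4.7) p.282] -/
theorem ineq547_dw1P_allTori_rSched {d L : ℕ} (hd : 2 ≤ d) (hd4 : d < 4) (hL : Odd L ∧ 1 < L) {r : ℝ} (hr : 1 < r) :
    ∃ c : ℝ, 0 < c ∧ ∀ᶠ ek in 𝓝[>] (0 : ℝ), ∀ (P : Params) (hPd : P.d = d) (_ : P.L = L) (k : ℕ) (_ : k ≤ P.m + P.K) (ε e : ℝ),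
      0 < ε → 0 < e → eK (L : ℝ) ε e d k = ek → ∀ (χ : PBond P k → ℝ), (∀ b', |χ b'| ≤ 1) →
        Ineq547 (TPlaq P 0) (PBond P k) (dw1P (hPd ▸ hd) (rSched (L : ℝ) ε e r d) k χ) (fun p b' => distEU P k p.src b'.src) c
          (rSched (L : ℝ) ε e r d k) := by
  obtain ⟨c, θ₀, ρ₁, hc, -, -, hA⟩ := ineq547_dw1P_allTori hd hL
  have hL1 : (1 : ℝ) < (L : ℝ) := by exact_mod_cast hL.2
  refine ⟨c, hc, ?_⟩
  filter_upwards [rSched_threshold_gap hd4 hL1 hr ρ₁ θ₀] with ek hek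
  intro P hPd hPL k hk ε e hε he hekk χ hχ
  obtain ⟨hρ, hgap⟩ := hek k ε e hε he hekk
  exact hA P hPd hPL k hk (rSched (L : ℝ) ε e r d) hρ hgap χ hχ

/-- **(5.4.7)-SHAPE FOR `∂*w′₁` WITH THE PRINTED RADII, ALL TORI, `e_k` SMALL** (`2 ≤ d < 4`, `L` odd `> 1`, `r > 1`): ONE `c > 0` such that
for all sufficiently small `e_k > 0` (uniformly in the torus, `k ≤ m + K`, `ε, e > 0` realizing `e_k`, `|χ| ≤ 1`),
`|(∂*w′₁)(x, b′)| ≤ e^{−c·r(e_k)}e^{−c·dist_k(x,b′₋)}` — `ineq547_sw1P_allTori` at the printed schedule via `rSched_threshold_gap`.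
[cite: BalabanImbrieJaffe1988, (5.4.7) p.282] -/
theorem ineq547_sw1P_allTori_rSched {d L : ℕ} (hd : 2 ≤ d) (hd4 : d < 4) (hL : Odd L ∧ 1 < L) {r : ℝ} (hr : 1 < r) :
    ∃ c : ℝ, 0 < c ∧ ∀ᶠ ek in 𝓝[>] (0 : ℝ), ∀ (P : Params) (hPd : P.d = d) (_ : P.L = L) (k : ℕ) (_ : k ≤ P.m + P.K) (ε e : ℝ),
      0 < ε → 0 < e → eK (L : ℝ) ε e d k = ek → ∀ (χ : PBond P k → ℝ), (∀ b', |χ b'| ≤ 1) →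
        Ineq547 (TSite P 0) (PBond P k) (sw1P (hPd ▸ hd) (rSched (L : ℝ) ε e r d) k χ) (fun x b' => distEU P k x b'.src) c
          (rSched (L : ℝ) ε e r d k) := by
  obtain ⟨c, θ₀, ρ₁, hc, -, -, hA⟩ := ineq547_sw1P_allTori hd hL
  have hL1 : (1 : ℝ) < (L : ℝ) := by exact_mod_cast hL.2
  refine ⟨c, hc, ?_⟩
  filter_upwards [rSched_threshold_gap hd4 hL1 hr ρ₁ θ₀] with ek hek
  intro P hPd hPL k hk ε e hε he hekk χ hχ
  obtain ⟨hρ, hgap⟩ := hek k ε e hε he hekk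
  exact hA P hPd hPL k hk (rSched (L : ℝ) ε e r d) hρ hgap χ hχ

end

end Literature.MathematicalPhysics.QuantumFieldTheory.BalabanImbrieJaffe1984to88.BIJ88W1PrimeCurlIneq547RSchedTorus
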